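import Mathlib.Algebra.Group.Subgroup.Even
import Mathlib.Topology.Algebra.Ring.Compact
import Literature.NumberTheory.QuadraticForms.QuadraticNormIndexLocal
import HarnessLib

/-!
# Square classes of `K_v` at every place: O'Meara 63:9, `(K_vˣ : K_vˣ²) = 4 · |𝒪_v / 2𝒪_v|`

Topic `NumberTheory/QuadraticForms`; namespace `Literature`; all declarations fully proved. Companion of
`QuadraticNormIndexLocal.lean`, which computes `(K_vˣ : K_vˣ²) = 4` at the **non-dyadic** places
(`index_square_eq_four`); here the count is done at **every** finite place `v` of a number field
`K`, dyadic ones included (O'Meara, *Introduction to quadratic forms*, §63A Prop. 63:9: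
`(Ḟ : Ḟ²) = 2 (𝔲 : 𝔲²) = 4 (N𝔭)^{ord_𝔭 2}`; we write the right-hand side as `4 |𝒪_v / 2𝒪_v|`).
This is the first input of the elementary (class-field-theory-free) computation of the local norm
index `(K_vˣ : N(K_v(√a)ˣ)) = 2` at the dyadic places (O'Meara 63:13a), the remaining local leaf
of the classification of quaternion algebras (`QuaternionAlgebraLocalUniqueness`,
`QuaternionAlgebraEmbeddingProofs` in `Literature/NumberTheory/Automorphic`).

Write `𝒪 = 𝒪_v`, `𝔪 = π𝒪` its maximal ideal, `𝔲 = 𝒪ˣ`, and `1 + c𝒪` for the congruence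
subgroup `ker (𝒪ˣ → (𝒪/c)ˣ)`.

* `map_powMonoidHom_two_congr` : **`(1 + 2π𝒪)² = 1 + 4π𝒪`** (63:8 (2) with `r = ord 2 + 1`):
  `1 + 4πz = (1 + 2y)²` is solved by Hensel's lemma for `Y² + Y - πz` (simple root `0` mod `𝔪`;
  `𝒪_v` is Henselian, `AdicCompletionHensel`).
* `mem_ker_powMonoidHom_two_iff`, `natCard_ker_powMonoidHom_two`,
  `ker_powMonoidHom_two_inf_congr_eq_bot` : the kernel of squaring on `𝔲` is `{±1}`, of order
  `2`, and meets `1 + 2π𝒪` trivially.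
* `relIndex_congr_four_two` : `(1 + 2π𝒪 : 1 + 4π𝒪) = |𝒪/2𝒪|` (`1 + 2πx ↦ x mod 2`).
* `index_range_powMonoidHom_two_units` : **`(𝔲 : 𝔲²) = 2 |𝒪/2𝒪|`**, by the index calculus of
  63:7–63:9 (Mathlib `Subgroup.index_map`, `Subgroup.relIndex_mul_index`): with `H = 1 + 2π𝒪`
  and `θ` the squaring map, `(𝔲 : θH) = (𝔲 : H·{±1}) (𝔲 : 𝔲²) = (𝔲 : H)(H : θH)` and
  `(𝔲 : H) = 2 (𝔲 : H·{±1})`.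
* `index_square_eq_four_mul_natCard` : **`(K_vˣ : K_vˣ²) = 4 |𝒪/2𝒪|`**: `K_vˣ² 𝔲` is the
  subgroup of elements of even valuation, of index `2`, and `(K_vˣ² 𝔲 : K_vˣ²) = (𝔲 : 𝔲 ∩ K_vˣ²) =
  (𝔲 : 𝔲²)`.

## References

* O. T. O'Meara, *Introduction to quadratic forms*, Grundlehren 117, Springer (1963), §63A:
  Local Square Theorem 63:1, Lemma 63:7, Prop. 63:8, Prop. 63:9 (PDF pp. 166–168).
-/

noncomputable section

open NumberField IsDedekindDomain Valued Polynomial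

namespace Literature.NumberTheory.QuadraticForms

variable (K : Type*) [Field K] [NumberField K] (v : HeightOneSpectrum (𝓞 K))

/-- The congruence subgroup `1 + c 𝒪_v` of `𝒪_vˣ`, as the kernel of `𝒪_vˣ → (𝒪_v / c 𝒪_v)ˣ`:
membership. [folklore] -/
theorem mem_ker_unitsMap_mk_span_iff (c : 𝒪[v.adicCompletion K]) (u : (𝒪[v.adicCompletion K])ˣ) :
    u ∈ (Units.map ((Ideal.Quotient.mk (Ideal.span {c})).toMonoidHom)).ker ↔
      ∃ x : 𝒪[v.adicCompletion K], (u : 𝒪[v.adicCompletion K]) = 1 + c * x := by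
  rw [MonoidHom.mem_ker, Units.ext_iff, Units.coe_map, RingHom.toMonoidHom_eq_coe,
    MonoidHom.coe_coe, Units.val_one, ← (Ideal.Quotient.mk (Ideal.span {c})).map_one,
    Ideal.Quotient.eq, Ideal.mem_span_singleton]
  constructor
  · rintro ⟨x, hx⟩
    exact ⟨x, by rw [← hx]; ring⟩
  · rintro ⟨x, hx⟩
    exact ⟨x, by rw [hx]; ring⟩

/-- **Squaring `1 + 2π𝒪_v` onto `1 + 4π𝒪_v`** (O'Meara 63:8 (2): `(1 + 𝔭^r)² = 1 + 2𝔭^r` for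
`𝔭^r ⊆ 2𝔭`, here `r = ord 2 + 1`): for a uniformiser `π`, every `1 + 4π z` is `(1 + 2y)²` with
`y ∈ π𝒪_v`, by Hensel's lemma applied to `Y² + Y - π z` (simple root `Y = 0` mod `𝔪`); and
`(1 + 2πx)² = 1 + 4π(x + πx²)`. [cite: Omeara1963, §63A Prop. 63:8] -/
theorem map_powMonoidHom_two_congr (π : 𝒪[v.adicCompletion K]) (hπ : Irreducible π) :
    ((Units.map ((Ideal.Quotient.mk (Ideal.span {2 * π})).toMonoidHom)).ker).map
        (powMonoidHom 2 : (𝒪[v.adicCompletion K])ˣ →* (𝒪[v.adicCompletion K])ˣ) =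
      (Units.map ((Ideal.Quotient.mk (Ideal.span {4 * π})).toMonoidHom)).ker := by
  haveI : HenselianLocalRing 𝒪[v.adicCompletion K] :=
    inferInstanceAs (HenselianLocalRing (v.adicCompletionIntegers K))
  haveI : IsDiscreteValuationRing 𝒪[v.adicCompletion K] :=
    inferInstanceAs (IsDiscreteValuationRing (v.adicCompletionIntegers K))
  ext u
  simp only [Subgroup.mem_map, mem_ker_unitsMap_mk_span_iff, powMonoidHom_apply]
  constructor
  · rintro ⟨w, ⟨x, hx⟩, rfl⟩
    exact ⟨x + π * x ^ 2, by rw [Units.val_pow_eq_pow_val, hx]; ring⟩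
  · rintro ⟨z, hz⟩
    -- solve `y² + y - π z = 0` by Hensel
    have hmonic : (X ^ 2 + X - C (π * z) : (𝒪[v.adicCompletion K])[X]).Monic := by
      have : (X ^ 2 + X - C (π * z) : (𝒪[v.adicCompletion K])[X]) =
          X ^ 2 + (X - C (π * z)) := by ring
      rw [this]
      exact (monic_X_pow 2).add_of_left (by
        rw [degree_X_pow]
        exact (degree_sub_le _ _).trans_lt (by
          rw [max_lt_iff]
          exact ⟨by rw [degree_X]; norm_num, (degree_C_le).trans_lt (by norm_num)⟩))
    have hπm : π ∈ IsLocalRing.maximalIdeal 𝒪[v.adicCompletion K] :=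
      hπ.maximalIdeal_eq ▸ Ideal.mem_span_singleton_self π
    have h0 : (X ^ 2 + X - C (π * z) : (𝒪[v.adicCompletion K])[X]).eval 0 ∈
        IsLocalRing.maximalIdeal 𝒪[v.adicCompletion K] := by
      simp only [eval_sub, eval_add, eval_pow, eval_X, eval_C, ne_eq, OfNat.ofNat_ne_zero,
        not_false_eq_true, zero_pow, add_zero, zero_sub, neg_mem_iff]
      exact Ideal.mul_mem_right _ _ hπm
    have h1 :
        IsUnit ((derivative (X ^ 2 + X - C (π * z) : (𝒪[v.adicCompletion K])[X])).eval 0) := by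
      simp
    obtain ⟨y, hy, hy0⟩ := HenselianLocalRing.is_henselian _ hmonic 0 h0 h1
    simp only [IsRoot.def, eval_sub, eval_add, eval_pow, eval_X, eval_C, sub_zero] at hy hy0
    -- `u = (1 + 2y)²`; `1 + 2y ∈ 1 + 2π𝒪` since `y ∈ 𝔪 = π𝒪`
    obtain ⟨t, ht⟩ : ∃ t : 𝒪[v.adicCompletion K], y = π * t := by
      have : y ∈ Ideal.span {π} := hπ.maximalIdeal_eq ▸ hy0
      obtain ⟨t, ht⟩ := Ideal.mem_span_singleton'.mp this
      exact ⟨t, by rw [← ht, mul_comm]⟩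
    have hu1 : IsUnit (1 + 2 * y : 𝒪[v.adicCompletion K]) := by
      by_contra h
      have hm : (1 + 2 * y : 𝒪[v.adicCompletion K]) ∈
          IsLocalRing.maximalIdeal 𝒪[v.adicCompletion K] :=
        (IsLocalRing.mem_maximalIdeal _).mpr (mem_nonunits_iff.mpr h)
      have h2y : (2 * y : 𝒪[v.adicCompletion K]) ∈ IsLocalRing.maximalIdeal 𝒪[v.adicCompletion K] :=
        Ideal.mul_mem_left _ _ hy0
      have h1 : (1 : 𝒪[v.adicCompletion K]) ∈ IsLocalRing.maximalIdeal 𝒪[v.adicCompletion K] := by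
        simpa using Ideal.sub_mem _ hm h2y
      exact (IsLocalRing.maximalIdeal.isMaximal 𝒪[v.adicCompletion K]).ne_top
        ((Ideal.eq_top_iff_one _).mpr h1)
    refine ⟨hu1.unit, ⟨t, by rw [IsUnit.unit_spec, ht]; ring⟩, Units.ext ?_⟩
    have hgoal : ((hu1.unit ^ 2 : (𝒪[v.adicCompletion K])ˣ) : 𝒪[v.adicCompletion K]) =
        (1 + 2 * y) ^ 2 := by
      rw [Units.val_pow_eq_pow_val, IsUnit.unit_spec]
    rw [hgoal, hz]
    linear_combination (4 : 𝒪[v.adicCompletion K]) * hy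

/-- `1 + m` is a unit of the local ring `𝒪_v` for `m ∈ 𝔪_v`. [folklore] -/
theorem isUnit_one_add_of_mem_maximalIdeal {m : 𝒪[v.adicCompletion K]}
    (hm : m ∈ IsLocalRing.maximalIdeal 𝒪[v.adicCompletion K]) :
    IsUnit (1 + m) := by
  by_contra h
  have h1 : (1 + m : 𝒪[v.adicCompletion K]) ∈ IsLocalRing.maximalIdeal 𝒪[v.adicCompletion K] :=
    (IsLocalRing.mem_maximalIdeal _).mpr (mem_nonunits_iff.mpr h)
  have : (1 : 𝒪[v.adicCompletion K]) ∈ IsLocalRing.maximalIdeal 𝒪[v.adicCompletion K] := by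
    simpa using Ideal.sub_mem _ h1 hm
  exact (IsLocalRing.maximalIdeal.isMaximal 𝒪[v.adicCompletion K]).ne_top
    ((Ideal.eq_top_iff_one _).mpr this)

/-- `2 ≠ 0` in `𝒪_v` (characteristic `0`). [folklore] -/
theorem two_ne_zero_integer : (2 : 𝒪[v.adicCompletion K]) ≠ 0 := by
  haveI : CharZero (v.adicCompletion K) :=
    charZero_of_injective_algebraMap (algebraMap K _).injective
  intro h
  have h' : ((2 : 𝒪[v.adicCompletion K]) : (v.adicCompletion K)) = 0 := by rw [h]; rfl
  norm_num at h'

/-- **The kernel of squaring on `𝒪_vˣ` is `{±1}`** (`𝒪_v` is a domain of characteristic `0`),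
a group of order `2`. [folklore] -/
theorem mem_ker_powMonoidHom_two_iff (u : (𝒪[v.adicCompletion K])ˣ) :
    u ∈ (powMonoidHom 2 : (𝒪[v.adicCompletion K])ˣ →* (𝒪[v.adicCompletion K])ˣ).ker ↔
      u = 1 ∨ u = -1 := by
  rw [MonoidHom.mem_ker, powMonoidHom_apply, Units.ext_iff, Units.val_pow_eq_pow_val, sq,
    Units.val_one, mul_self_eq_one_iff, ← Units.val_one, ← Units.val_neg, ← Units.ext_iff,
    ← Units.ext_iff]

/-- The kernel `{±1}` of squaring on `𝒪_vˣ` has two elements. [folklore] -/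
theorem natCard_ker_powMonoidHom_two :
    Nat.card (powMonoidHom 2 : (𝒪[v.adicCompletion K])ˣ →* (𝒪[v.adicCompletion K])ˣ).ker = 2 := by
  rw [Nat.card_eq_two_iff]
  refine ⟨⟨1, (mem_ker_powMonoidHom_two_iff K v 1).mpr (Or.inl rfl)⟩,
    ⟨-1, (mem_ker_powMonoidHom_two_iff K v (-1)).mpr (Or.inr rfl)⟩, ?_, ?_⟩
  · intro h
    have h1 : ((1 : (𝒪[v.adicCompletion K])ˣ) : 𝒪[v.adicCompletion K]) =
        ((-1 : (𝒪[v.adicCompletion K])ˣ) : 𝒪[v.adicCompletion K]) := by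
      rw [Subtype.ext_iff] at h
      exact congrArg Units.val h
    rw [Units.val_one, Units.val_neg, Units.val_one, eq_neg_iff_add_eq_zero, one_add_one_eq_two]
      at h1
    exact two_ne_zero_integer K v h1
  · ext ⟨u, hu⟩
    simp only [Set.mem_insert_iff, Set.mem_singleton_iff, Set.mem_univ, iff_true]
    rcases (mem_ker_powMonoidHom_two_iff K v u).mp hu with rfl | rfl
    · exact Or.inl rfl
    · exact Or.inr rfl

/-- `-1 ∉ 1 + 2π𝒪_v`: the kernel of squaring meets the congruence subgroup `1 + 2π𝒪_v`
trivially (`-2 = 2πx` would make `π` a unit). [folklore] -/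
theorem ker_powMonoidHom_two_inf_congr_eq_bot (π : 𝒪[v.adicCompletion K]) (hπ : Irreducible π) :
    (Units.map ((Ideal.Quotient.mk (Ideal.span {2 * π})).toMonoidHom)).ker ⊓
      (powMonoidHom 2 : (𝒪[v.adicCompletion K])ˣ →* (𝒪[v.adicCompletion K])ˣ).ker = ⊥ := by
  rw [eq_bot_iff]
  intro u ⟨hu, hk⟩
  rw [Subgroup.mem_bot]
  rcases (mem_ker_powMonoidHom_two_iff K v u).mp hk with rfl | rfl
  · rfl
  · exfalso
    obtain ⟨x, hx⟩ := (mem_ker_unitsMap_mk_span_iff K v (2 * π) (-1)).mp hu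
    rw [Units.val_neg, Units.val_one, eq_comm, ← sub_eq_zero] at hx
    have h2 : (2 : 𝒪[v.adicCompletion K]) * (1 + π * x) = 0 := by linear_combination hx
    rcases mul_eq_zero.mp h2 with h | h
    · exact two_ne_zero_integer K v h
    · apply hπ.not_isUnit
      have hπx : IsUnit (π * x) := by
        have : π * x = -1 := by linear_combination h
        rw [this]; exact isUnit_one.neg
      exact isUnit_of_mul_isUnit_left hπx

/-- **`(1 + 2π𝒪_v : 1 + 4π𝒪_v) = |𝒪_v / 2𝒪_v|`**: `u = 1 + 2πx ↦ x mod 2` is a surjective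
homomorphism `1 + 2π𝒪_v → 𝒪_v/2𝒪_v` with kernel `1 + 4π𝒪_v` (O'Meara 63:8:
`(1 + 𝔭^r)/(1 + 𝔭^{r + ord 2}) ≅ 𝔭^r / 2𝔭^r`). [cite: Omeara1963, §63A Prop. 63:8] -/
theorem relIndex_congr_four_two (π : 𝒪[v.adicCompletion K]) (hπ : Irreducible π) :
    ((Units.map ((Ideal.Quotient.mk (Ideal.span {4 * π})).toMonoidHom)).ker).relIndex
        (Units.map ((Ideal.Quotient.mk (Ideal.span {2 * π})).toMonoidHom)).ker =
      Nat.card (𝒪[v.adicCompletion K] ⧸ Ideal.span {(2 : 𝒪[v.adicCompletion K])}) := by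
  haveI : IsDiscreteValuationRing 𝒪[v.adicCompletion K] :=
    inferInstanceAs (IsDiscreteValuationRing (v.adicCompletionIntegers K))
  set H₂ := (Units.map ((Ideal.Quotient.mk (Ideal.span {2 * π})).toMonoidHom)).ker with hH₂
  set H₄ := (Units.map ((Ideal.Quotient.mk (Ideal.span {4 * π})).toMonoidHom)).ker with hH₄
  have h2π : (2 * π : 𝒪[v.adicCompletion K]) ≠ 0 := mul_ne_zero (two_ne_zero_integer K v) hπ.ne_zero
  -- `t u`: the `x` with `u = 1 + 2π x`
  have ht : ∀ u : H₂, ∃ x : 𝒪[v.adicCompletion K],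
      ((u : (𝒪[v.adicCompletion K])ˣ) : 𝒪[v.adicCompletion K]) = 1 + 2 * π * x := fun u ↦
    (mem_ker_unitsMap_mk_span_iff K v (2 * π) u).mp u.2
  choose t ht using ht
  have ht_unique : ∀ (u : H₂) (x : 𝒪[v.adicCompletion K]),
      ((u : (𝒪[v.adicCompletion K])ˣ) : 𝒪[v.adicCompletion K]) = 1 + 2 * π * x → t u = x := by
    intro u x hx
    have h := (ht u).symm.trans hx
    have h0 : (2 * π) * (t u - x) = 0 := by linear_combination h
    rcases mul_eq_zero.mp h0 with h' | h'
    · exact absurd h' h2π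
    · exact sub_eq_zero.mp h'
  let δ : H₂ →* Multiplicative (𝒪[v.adicCompletion K] ⧸ Ideal.span {(2 : 𝒪[v.adicCompletion K])}) :=
    { toFun := fun u ↦ Multiplicative.ofAdd (Ideal.Quotient.mk _ (t u))
      map_one' := by
        have : t 1 = 0 := ht_unique 1 0 (by simp)
        rw [this, map_zero]; rfl
      map_mul' := fun u u' ↦ by
        rw [← ofAdd_add, ← map_add]
        congr 1
        have hmul : t (u * u') = t u + t u' + 2 * (π * t u * t u') := by
          apply ht_unique
          have h1 := ht u
          have h2 := ht u'
          rw [Subgroup.coe_mul, Units.val_mul, h1, h2]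
          ring
        rw [hmul, Ideal.Quotient.eq, Ideal.mem_span_singleton]
        exact ⟨π * t u * t u', by ring⟩ }
  have hδ_surj : Function.Surjective δ := by
    intro y
    obtain ⟨x, hx⟩ := Ideal.Quotient.mk_surjective (Multiplicative.toAdd y)
    have hπm : π ∈ IsLocalRing.maximalIdeal 𝒪[v.adicCompletion K] :=
      hπ.maximalIdeal_eq ▸ Ideal.mem_span_singleton_self π
    have hu : IsUnit (1 + 2 * π * x : 𝒪[v.adicCompletion K]) := by
      refine isUnit_one_add_of_mem_maximalIdeal K v ?_
      rw [mul_assoc]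
      exact Ideal.mul_mem_left _ _ (Ideal.mul_mem_right _ _ hπm)
    have hmem : hu.unit ∈ H₂ :=
      (mem_ker_unitsMap_mk_span_iff K v (2 * π) _).mpr ⟨x, by rw [IsUnit.unit_spec]⟩
    refine ⟨⟨hu.unit, hmem⟩, ?_⟩
    show Multiplicative.ofAdd (Ideal.Quotient.mk _ (t ⟨hu.unit, hmem⟩)) = y
    rw [ht_unique ⟨hu.unit, hmem⟩ x (by simp [IsUnit.unit_spec]), hx]
    rfl
  have hδ_ker : δ.ker = H₄.subgroupOf H₂ := by
    ext u
    rw [MonoidHom.mem_ker, Subgroup.mem_subgroupOf, hH₄, mem_ker_unitsMap_mk_span_iff]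
    show Multiplicative.ofAdd (Ideal.Quotient.mk _ (t u)) = 1 ↔ _
    rw [← ofAdd_zero, Multiplicative.ofAdd.apply_eq_iff_eq, Ideal.Quotient.eq_zero_iff_mem,
      Ideal.mem_span_singleton]
    constructor
    · rintro ⟨s, hs⟩
      exact ⟨s, by rw [ht u, hs]; ring⟩
    · rintro ⟨s, hs⟩
      exact ⟨s, by rw [ht_unique u (2 * s) (by rw [hs]; ring)]⟩
  rw [Subgroup.relIndex, ← hδ_ker, Subgroup.index_ker, MonoidHom.range_eq_top.mpr hδ_surj,
    Subgroup.card_top]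
  rfl

/-- `𝒪_v / c 𝒪_v` is finite for `c ≠ 0`: `c 𝒪_v = 𝔪^n` in the discrete valuation ring `𝒪_v`,
and `𝒪_v/𝔪^n` is finite since the residue field is (Mathlib `Ideal.finite_quotient_pow`).
[folklore] -/
theorem finite_quotient_span_singleton {c : 𝒪[v.adicCompletion K]} (hc : c ≠ 0) :
    Finite (𝒪[v.adicCompletion K] ⧸ Ideal.span {c}) := by
  haveI : IsDiscreteValuationRing 𝒪[v.adicCompletion K] :=
    inferInstanceAs (IsDiscreteValuationRing (v.adicCompletionIntegers K))
  haveI : Finite (𝒪[v.adicCompletion K] ⧸ IsLocalRing.maximalIdeal 𝒪[v.adicCompletion K]) :=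
    Literature.NumberTheory.Automorphic.finite_residueField_adicCompletion K v
  obtain ⟨π, hπ⟩ := IsDiscreteValuationRing.exists_irreducible 𝒪[v.adicCompletion K]
  have hs : Ideal.span {c} ≠ ⊥ := by rwa [Ne, Ideal.span_singleton_eq_bot]
  obtain ⟨n, hn⟩ := IsDiscreteValuationRing.ideal_eq_span_pow_irreducible hs hπ
  rw [hn, ← Ideal.span_singleton_pow, ← hπ.maximalIdeal_eq]
  exact Ideal.finite_quotient_pow (IsNoetherian.noetherian _) n

/-- The congruence subgroup `1 + c 𝒪_v` (`c ≠ 0`) has finite index in `𝒪_vˣ` (at most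
`|(𝒪_v/c)ˣ|`). [folklore] -/
theorem index_congr_ne_zero {c : 𝒪[v.adicCompletion K]} (hc : c ≠ 0) :
    ((Units.map ((Ideal.Quotient.mk (Ideal.span {c})).toMonoidHom)).ker).index ≠ 0 := by
  haveI := finite_quotient_span_singleton K v hc
  rw [Subgroup.index_ker]
  exact Nat.card_pos.ne'

/-- **`(𝒪_vˣ : 𝒪_vˣ²) = 2 |𝒪_v / 2𝒪_v|`** (O'Meara 63:9: `(𝔲 : 𝔲²) = 2 (N𝔭)^{ord_𝔭 2}`, dyadic or
not). With `H = 1 + 2π𝒪_v`, `θ = ` squaring: `(𝒪_vˣ : θH) = (𝒪_vˣ : H ± 1)(𝒪_vˣ : 𝒪_vˣ²)`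
(Mathlib `Subgroup.index_map`), `(𝒪_vˣ : H) = 2 (𝒪_vˣ : H ± 1)` (`-1 ∉ H`), and
`(𝒪_vˣ : θH) = (𝒪_vˣ : H)(H : θH)` with `θH = 1 + 4π𝒪_v`, `(H : θH) = |𝒪_v/2𝒪_v|`.
[cite: Omeara1963, §63A Prop. 63:9] -/
theorem index_range_powMonoidHom_two_units :
    ((powMonoidHom 2 : (𝒪[v.adicCompletion K])ˣ →* (𝒪[v.adicCompletion K])ˣ).range).index =
      2 * Nat.card (𝒪[v.adicCompletion K] ⧸ Ideal.span {(2 : 𝒪[v.adicCompletion K])}) := by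
  haveI : IsDiscreteValuationRing 𝒪[v.adicCompletion K] :=
    inferInstanceAs (IsDiscreteValuationRing (v.adicCompletionIntegers K))
  obtain ⟨π, hπ⟩ := IsDiscreteValuationRing.exists_irreducible 𝒪[v.adicCompletion K]
  set θ : (𝒪[v.adicCompletion K])ˣ →* (𝒪[v.adicCompletion K])ˣ := powMonoidHom 2 with hθ
  set H := (Units.map ((Ideal.Quotient.mk (Ideal.span {2 * π})).toMonoidHom)).ker with hH
  have h2π : (2 * π : 𝒪[v.adicCompletion K]) ≠ 0 := mul_ne_zero (two_ne_zero_integer K v) hπ.ne_zero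
  -- (1) `index_map`
  have h1 : (H.map θ).index = (H ⊔ θ.ker).index * θ.range.index := Subgroup.index_map H θ
  -- (2) `θH ≤ H`
  have hmap : H.map θ = (Units.map ((Ideal.Quotient.mk (Ideal.span {4 * π})).toMonoidHom)).ker :=
    map_powMonoidHom_two_congr K v π hπ
  have hle : H.map θ ≤ H := by
    rw [hmap]
    intro u hu
    obtain ⟨x, hx⟩ := (mem_ker_unitsMap_mk_span_iff K v _ u).mp hu
    exact (mem_ker_unitsMap_mk_span_iff K v _ u).mpr ⟨2 * x, by rw [hx]; ring⟩
  have h2 : (H.map θ).relIndex H * H.index = (H.map θ).index := Subgroup.relIndex_mul_index hle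
  -- (3) `H ≤ H ⊔ ker`
  have h3 : H.relIndex (H ⊔ θ.ker) * (H ⊔ θ.ker).index = H.index :=
    Subgroup.relIndex_mul_index le_sup_left
  -- (4) `(H ⊔ ker : H) = |ker| = 2`
  have h4 : H.relIndex (H ⊔ θ.ker) = 2 := by
    rw [Subgroup.relIndex_sup_left, ← Subgroup.inf_relIndex_right,
      ker_powMonoidHom_two_inf_congr_eq_bot K v π hπ, Subgroup.relIndex_bot_left,
      natCard_ker_powMonoidHom_two]
  -- (5) `(H : θH) = |𝒪/2|`
  have h5 : (H.map θ).relIndex H =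
      Nat.card (𝒪[v.adicCompletion K] ⧸ Ideal.span {(2 : 𝒪[v.adicCompletion K])}) := by
    rw [hmap]; exact relIndex_congr_four_two K v π hπ
  -- finiteness
  have hH0 : H.index ≠ 0 := index_congr_ne_zero K v h2π
  have hHK0 : (H ⊔ θ.ker).index ≠ 0 := fun h0 ↦ hH0 (by
    have := Subgroup.index_dvd_of_le (le_sup_left : H ≤ H ⊔ θ.ker)
    rw [h0, zero_dvd_iff] at this
    exact this)
  -- algebra: `h5 * (2 * X) = X * range.index` with `X = (H ⊔ ker).index ≠ 0`
  have key : (H ⊔ θ.ker).index * θ.range.index =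
      (H ⊔ θ.ker).index *
        (2 * Nat.card (𝒪[v.adicCompletion K] ⧸ Ideal.span {(2 : 𝒪[v.adicCompletion K])})) := by
    rw [← h1, ← h2, h5, ← h3, h4]
    ring
  exact mul_left_cancel₀ hHK0 key

/-! ### From `𝒪_vˣ` to `K_vˣ` -/

/-- The units of `𝒪_v` inside `K_vˣ`: the range of `𝒪_vˣ → K_vˣ` is the subgroup of elements of
valuation `1`. [folklore] -/
theorem mem_range_unitsMap_integer_iff (x : (v.adicCompletion K)ˣ) :
    x ∈ (Units.map ((Valued.integer (v.adicCompletion K)).subtype.toMonoidHom)).range ↔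
      Valued.v (x : (v.adicCompletion K)) = 1 := by
  constructor
  · rintro ⟨u, rfl⟩
    exact (isUnit_integer_iff K v (u : 𝒪[v.adicCompletion K])).mp u.isUnit
  · intro hx
    have hu : IsUnit (⟨(x : (v.adicCompletion K)), hx.le⟩ : 𝒪[v.adicCompletion K]) :=
      (isUnit_integer_iff K v _).mpr hx
    exact ⟨hu.unit, Units.ext (by simp [IsUnit.unit_spec])⟩

/-- **O'Meara 63:9 at every place: `(K_vˣ : K_vˣ²) = 4 |𝒪_v / 2𝒪_v|`** (`= 4 (N v)^{ord_v 2}`;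
at a non-dyadic place `2𝒪_v = 𝒪_v` and the index is `4`, `index_square_eq_four`). From
`(𝒪_vˣ : 𝒪_vˣ²) = 2 |𝒪_v/2𝒪_v|` (`index_range_powMonoidHom_two_units`) and the valuation:
`K_vˣ² · 𝒪_vˣ` is the subgroup of elements of even valuation, of index `2`, and
`(K_vˣ² 𝒪_vˣ : K_vˣ²) = (𝒪_vˣ : 𝒪_vˣ ∩ K_vˣ²) = (𝒪_vˣ : 𝒪_vˣ²)`.
[cite: Omeara1963, §63A Prop. 63:9] -/
theorem index_square_eq_four_mul_natCard :
    (Subgroup.square (v.adicCompletion K)ˣ).index =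
      4 * Nat.card (𝒪[v.adicCompletion K] ⧸ Ideal.span {(2 : 𝒪[v.adicCompletion K])}) := by
  -- notation
  set ι : (𝒪[v.adicCompletion K])ˣ →* (v.adicCompletion K)ˣ :=
    Units.map ((Valued.integer (v.adicCompletion K)).subtype.toMonoidHom) with hι
  set S : Subgroup (v.adicCompletion K)ˣ := Subgroup.square (v.adicCompletion K)ˣ with hS
  set U : Subgroup (v.adicCompletion K)ˣ := ι.range with hU
  have hι_inj : Function.Injective ι := fun a b h ↦ by
    apply Units.ext; apply Subtype.ext
    have := congrArg (fun u : (v.adicCompletion K)ˣ ↦ (u : (v.adicCompletion K))) h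
    simpa [hι] using this
  have hι_val : ∀ u : (𝒪[v.adicCompletion K])ˣ,
      ((ι u : (v.adicCompletion K)ˣ) : (v.adicCompletion K)) =
        ((u : 𝒪[v.adicCompletion K]) : (v.adicCompletion K)) := fun u ↦ rfl
  -- a uniformiser
  obtain ⟨π₀, hπ₀⟩ := v.valuation_exists_uniformizer K
  have hϖ : Valued.v (algebraMap K (v.adicCompletion K) π₀) = WithZero.exp (-1) := by
    have hval : Valued.v (algebraMap K (v.adicCompletion K) π₀) = v.valuation K π₀ :=
      HeightOneSpectrum.valuedAdicCompletion_eq_valuation' v π₀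
    rw [hval, hπ₀]
  have hϖ0 : algebraMap K (v.adicCompletion K) π₀ ≠ 0 := by
    intro h; rw [h, map_zero] at hϖ; exact WithZero.coe_ne_zero hϖ.symm
  set ϖ : (v.adicCompletion K)ˣ := Units.mk0 _ hϖ0 with hϖdef
  -- the subgroup of elements of even valuation
  let E : Subgroup (v.adicCompletion K)ˣ :=
    { carrier := {x | ∃ k : ℤ, Valued.v (x : (v.adicCompletion K)) = WithZero.exp (2 * k)}
      mul_mem' := by
        rintro x y ⟨k, hk⟩ ⟨l, hl⟩
        exact ⟨k + l, by rw [Units.val_mul, map_mul, hk, hl, ← WithZero.exp_add]; ring_nf⟩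
      one_mem' := ⟨0, by simp⟩
      inv_mem' := by
        rintro x ⟨k, hk⟩
        exact ⟨-k, by rw [Units.val_inv_eq_inv_val, map_inv₀, hk, ← WithZero.exp_neg]; ring_nf⟩ }
  have hE : ∀ x : (v.adicCompletion K)ˣ,
      x ∈ E ↔ ∃ k : ℤ, Valued.v (x : (v.adicCompletion K)) = WithZero.exp (2 * k) := fun x ↦
    Iff.rfl
  -- every unit has valuation `exp n`
  have hlog : ∀ x : (v.adicCompletion K)ˣ, Valued.v (x : (v.adicCompletion K)) =
      WithZero.exp (WithZero.log (Valued.v (x : (v.adicCompletion K)))) :=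
    fun x ↦ (WithZero.exp_log ((Valuation.ne_zero_iff Valued.v).2 x.ne_zero)).symm
  -- valuation of powers of `ϖ`
  have hϖpow : ∀ k : ℤ, Valued.v (((ϖ ^ k : (v.adicCompletion K)ˣ) : (v.adicCompletion K))) =
      WithZero.exp (-k) := fun k ↦ by
    rw [Units.val_zpow_eq_zpow_val, map_zpow₀, hϖdef, Units.val_mk0, hϖ, ← WithZero.exp_zsmul,
      smul_eq_mul, mul_neg_one]
  -- (i) `E` has index `2`
  have hE2 : E.index = 2 := by
    rw [Subgroup.index_eq_two_iff]
    refine ⟨ϖ, fun b ↦ ?_⟩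
    set n := WithZero.log (Valued.v (b : (v.adicCompletion K))) with hn
    have hb : Valued.v (b : (v.adicCompletion K)) = WithZero.exp n := hlog b
    have hbϖ : Valued.v ((b * ϖ : (v.adicCompletion K)ˣ) : (v.adicCompletion K)) =
        WithZero.exp (n - 1) := by
      rw [Units.val_mul, map_mul, hb, ← zpow_one ϖ, hϖpow 1, ← WithZero.exp_add, sub_eq_add_neg]
    rcases Int.even_or_odd n with ⟨m, hm⟩ | ⟨m, hm⟩
    · -- `n` even: `b ∈ E`, `b ϖ ∉ E`
      refine Or.inr ⟨(hE b).mpr ⟨m, by rw [hb, hm, two_mul]⟩, fun hmem ↦ ?_⟩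
      obtain ⟨k, hk⟩ := (hE _).mp hmem
      rw [hbϖ, WithZero.exp_inj] at hk
      omega
    · -- `n` odd: `b ϖ ∈ E`, `b ∉ E`
      refine Or.inl ⟨(hE _).mpr ⟨m, by rw [hbϖ, hm]; ring_nf⟩, fun hmem ↦ ?_⟩
      obtain ⟨k, hk⟩ := (hE _).mp hmem
      rw [hb, WithZero.exp_inj] at hk
      omega
  -- (ii) `S ⊔ U = E`
  have hSU : S ⊔ U = E := by
    apply le_antisymm
    · rw [sup_le_iff]
      constructor
      · rintro x ⟨r, rfl⟩
        set n := WithZero.log (Valued.v (r : (v.adicCompletion K))) with hn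
        have hr : Valued.v (r : (v.adicCompletion K)) = WithZero.exp n := hlog r
        exact (hE _).mpr ⟨n, by rw [Units.val_mul, map_mul, hr, ← WithZero.exp_add, two_mul]⟩
      · rintro x hx
        exact (hE _).mpr ⟨0, by rw [(mem_range_unitsMap_integer_iff K v x).mp hx, mul_zero,
          WithZero.exp_zero]⟩
    · intro x hx
      obtain ⟨k, hk⟩ := (hE x).mp hx
      -- `x ϖ^{2k}` has valuation `1`, `ϖ^{-2k}` is a square
      have hu : x * ϖ ^ (k + k) ∈ U := by
        rw [hU, mem_range_unitsMap_integer_iff, Units.val_mul, map_mul, hk, hϖpow,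
          ← WithZero.exp_add]
        convert WithZero.exp_zero using 2
        ring
      have hs : (ϖ ^ (k + k))⁻¹ ∈ S := by
        rw [hS, Subgroup.mem_square]
        exact ⟨(ϖ ^ k)⁻¹, by rw [← mul_inv, ← zpow_add]⟩
      have hx' : x = (x * ϖ ^ (k + k)) * (ϖ ^ (k + k))⁻¹ := (mul_inv_cancel_right _ _).symm
      rw [hx', sup_comm]
      exact Subgroup.mul_mem_sup hu hs
  -- (iii) `S.index = S.relIndex U * 2`
  have h3 : S.index = S.relIndex U * 2 := by
    rw [← hE2, ← hSU, ← Subgroup.relIndex_sup_left (K := S) (H := U),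
      Subgroup.relIndex_mul_index (le_sup_left : S ≤ S ⊔ U)]
  -- (iv) `S.relIndex U = (𝒪ˣ² : 𝒪ˣ)` by transport along `ι`
  have h4 : S.relIndex U =
      ((powMonoidHom 2 : (𝒪[v.adicCompletion K])ˣ →* (𝒪[v.adicCompletion K])ˣ).range).index := by
    have hmap :
        (powMonoidHom 2 : (𝒪[v.adicCompletion K])ˣ →* (𝒪[v.adicCompletion K])ˣ).range.map ι =
          S ⊓ U := by
      ext x
      constructor
      · rintro ⟨w, ⟨u, rfl⟩, rfl⟩
        refine Subgroup.mem_inf.mpr ⟨?_, ⟨u ^ 2, rfl⟩⟩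
        rw [hS, Subgroup.mem_square]
        exact ⟨ι u, by rw [powMonoidHom_apply, map_pow, sq]⟩
      · intro hx
        obtain ⟨hxS, hxU⟩ := Subgroup.mem_inf.mp hx
        rw [hS, Subgroup.mem_square] at hxS
        obtain ⟨r, rfl⟩ := hxS
        have hr : Valued.v (r : (v.adicCompletion K)) = 1 := by
          have h1 := (mem_range_unitsMap_integer_iff K v _).mp hxU
          rw [Units.val_mul, map_mul, ← sq] at h1
          exact sq_eq_one.mp h1
        obtain ⟨u, hu⟩ := (mem_range_unitsMap_integer_iff K v r).mpr hr
        exact ⟨u ^ 2, ⟨u, rfl⟩, by rw [map_pow, hu, sq]⟩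
    rw [← Subgroup.inf_relIndex_right, ← hmap, hU, MonoidHom.range_eq_map ι,
      Subgroup.relIndex_map_map_of_injective _ _ hι_inj, Subgroup.relIndex_top_right]
  rw [h3, h4, index_range_powMonoidHom_two_units]
  ring

end Literature.NumberTheory.QuadraticForms
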